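import Mathlib.Analysis.Convex.SimplicialComplex.Basic
import Mathlib.Analysis.Convex.Topology
import Mathlib.Analysis.InnerProductSpace.PiL2
import Mathlib.Logic.Relation
import Mathlib.LinearAlgebra.AffineSpace.AffineSubspace.Basic
import Mathlib.Geometry.Manifold.MFDeriv.Basic
import Mathlib.Geometry.Manifold.SmoothEmbedding
import Mathlib.Geometry.Manifold.Instances.Real
import Literature.Analysis.Convexity.PLMap
import Literature.Topology.FourManifolds.ClosedBall
import Literature.Topology.FourManifolds.SmoothTriangulation
import HarnessLib

/-!
# Collapsible simplicial complexes; smoothly collapsible subsets of a smooth manifold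

Topic `Literature/Topology/FourManifolds`; definition request `defn-IsCollapsible` (route
`SmoothPoincare4/CutLocusSpine`, card `cut-locus-spines-maxwell`: "a homotopy 4-sphere carrying
`(g, p)` with smoothly collapsible cut locus is `S⁴`").

## Contents

* `IsFreeFace F σ τ`, `IsElementaryCollapse F G`, `FaceCollapses F G` (`F ↘ G`) and
  `IsFaceCollapsible F` for a family of faces `F : Set (Finset ι)`: simplicial collapsing
  (Whitehead 1939, §3; Rourke–Sanderson 1972, Ch. 3; Cohen, *A course in simple-homotopy theory*
  (1973), §2), with the API `IsFreeFace.isRelLowerSet_diff` (a collapse of a complex is a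
  subcomplex), `FaceCollapses.subset/finite/isRelLowerSet`, `IsFaceCollapsible.finite`, and the
  worked example `isFaceCollapsible_segment` (`{a, b, ab} ↘ {b}`).
* For Mathlib's geometric complexes `K L : Geometry.SimplicialComplex 𝕜 E`: `Collapses K L`,
  **`IsCollapsible K`** (`K ↘` a vertex; automatically finite) and `eraseFreePair K σ τ h`.
* `IsSmoothComplexEmbedding n K f`: `f : E^N → M` restricts to a topological embedding of the
  polyhedron `|K|` of the *finite* complex `K` which is `C^∞` and non-degenerate on each closed
  simplex — the clause of `Literature.Topology.FourManifolds.IsSmoothTriangulation`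
  (`SmoothTriangulation.lean`; Whitehead 1940, §1; Munkres 1966, Def. 8.1/8.3) verbatim, for a map
  which need not be onto `M`.
* **`IsSmoothlyCollapsible n s`**: `s = f(|K₀|)` for a collapsible subcomplex `K₀ ≤ K` of such a
  smoothly embedded finite complex whose image `f(|K|)` is a neighbourhood of `s`; i.e. `s` is a
  compact collapsible subpolyhedron of a smooth triangulation of a neighbourhood of `s`.  A
  collapsible subcomplex of a smooth triangulation of `M` qualifies
  (`IsSmoothTriangulation.isSmoothlyCollapsible_image`).
* The named fact `exists_isSmoothEmbedding_closedBall_of_isSmoothlyCollapsible`: **a smoothly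
  collapsible subset has arbitrarily small neighbourhoods which are smoothly embedded closed
  balls** (Whitehead 1939 / Rourke–Sanderson 1972, Cor. 3.27 / Hog-Angeloni–Metzler 1993,
  Ch. I (43)–(46): a regular neighbourhood of a collapsible polyhedron in a PL manifold is a PL
  ball; Hirsch 1962: smooth regular neighbourhoods
  of a subcomplex of a smooth triangulation exist inside any neighbourhood, are unique up to
  diffeomorphism and unchanged under collapsing `K ↘ L`, hence are discs for collapsible `K`).

## Design

* Collapsing is combinatorial, so it is defined on `Set (Finset ι)` and specialised to
  `Geometry.SimplicialComplex` through `faces`.  `FaceCollapses` is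
  `Relation.ReflTransGen IsElementaryCollapse`: literally "the faces other than one vertex are
  ordered into pairs `(σᵢ ⊂ τᵢ)`, `dim τᵢ = dim σᵢ + 1`, `σᵢ` free in what is left after removing
  the pairs `j < i`".  The clause `τ.card = σ.card + 1` is kept as requested (for a down-closed
  family it follows from freeness).
* `IsSmoothlyCollapsible` asks that the embedded finite complex `K ⊇ K₀` cover a *neighbourhood*
  of `s`: the regular-neighbourhood theorems are about subcomplexes of (smooth) triangulations of
  manifolds, and on `f ⁻¹(interior f(|K|))` a non-degenerate `C^∞` homeomorphism is a `C^∞`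
  triangulation of that open submanifold (Munkres 1966, Thm. 8.4), in which `K₀` is a finite
  collapsible subcomplex.  The target `M` need not be compact (unlike `IsSmoothTriangulation`,
  whose complex is finite and onto).  Balls in `M` are smooth embeddings `𝔻ⁿ⁺¹ → M` of the
  closed unit ball with its manifold-with-boundary structure (`ClosedBall.lean`), the format of
  `IsTwistedSphere` / `BallGluingData`.  Not here: PL regular neighbourhoods, invariance of
  collapsibility under subdivision, cut loci.

## References

* J. H. C. Whitehead, *Simplicial spaces, nuclei and m-groups*, Proc. LMS (2) 45 (1939) 243–327,
  §3 (collapsing; regular neighbourhoods and the ball characterisation later in the paper).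
  [Whitehead1939]
* C. P. Rourke, B. J. Sanderson, *Introduction to piecewise-linear topology* (1972), Ch. 3,
  Cor. 3.27. [RourkeSanderson1972]
* M. W. Hirsch, *Smooth regular neighborhoods*, Ann. of Math. 76 (1962) 524–530. [Hirsch1962]
* J. R. Munkres, *Elementary differential topology*, Ann. of Math. Studies 54 (1963; rev. 1966),
  Def. 8.1, 8.3, Thm. 8.4, §10. [Munkres1966]
* C. Hog-Angeloni, W. Metzler, *Geometric aspects of two-dimensional complexes*, Ch. I of
  *Two-dimensional homotopy and combinatorial group theory*, LMS LNS 197 (1993), §2 (collapses),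
  §3 (43)–(47) (regular neighbourhoods; Whitehead's characterisation of PL balls).
  [HogAngeloniMetzler1993]
-/

open scoped Manifold ContDiff Topology
open Set Function Topology

noncomputable section

namespace Literature.Topology.FourManifolds

/-! ### Simplicial collapsing of families of faces -/

section Faces

variable {ι : Type*}

/-- `IsFreeFace F σ τ`: in the family of faces `F`, the face `σ` is a **free face** of `τ`:
both belong to `F`, `σ ⊂ τ` with `dim τ = dim σ + 1` (`τ.card = σ.card + 1`), and `τ` is the
*only* face of `F` properly containing `σ` (so `τ` is a facet).  Removing such a pair is an
elementary simplicial collapse.  Whitehead (1939), §3; Rourke–Sanderson (1972), Ch. 3.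
[cite: Whitehead1939, §3] -/
def IsFreeFace (F : Set (Finset ι)) (σ τ : Finset ι) : Prop :=
  σ ∈ F ∧ τ ∈ F ∧ σ ⊂ τ ∧ τ.card = σ.card + 1 ∧ ∀ ρ ∈ F, σ ⊂ ρ → ρ = τ

/-- `IsElementaryCollapse F G`: `G` is obtained from `F` by an **elementary (simplicial)
collapse**, i.e. `G = F ∖ {σ, τ}` for a free face `σ` of `τ` in `F` (`F = G ∪ {τ, σ}` with
`σ, τ ∉ G`).  Whitehead (1939), §3; Rourke–Sanderson (1972), Ch. 3; Hog-Angeloni–Metzler (1993),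
Ch. I §2, Definition (elementary collapse `K = L ∪ eⁿ ∪ eⁿ⁻¹`, simplicial case).
[cite: Whitehead1939, §3] [cite: HogAngeloniMetzler1993, Ch. I §2 Definition (elementary collapse)] -/
def IsElementaryCollapse (F G : Set (Finset ι)) : Prop :=
  ∃ σ τ : Finset ι, IsFreeFace F σ τ ∧ G = F \ {σ, τ}

/-- `FaceCollapses F G`, "`F ↘ G`": `F` **collapses simplicially** to `G`, i.e. `G` is reached
from `F` by a finite sequence of elementary collapses (reflexive–transitive closure of
`IsElementaryCollapse`).  Whitehead (1939), §3; Rourke–Sanderson (1972), Ch. 3.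
[cite: Whitehead1939, §3] -/
def FaceCollapses : Set (Finset ι) → Set (Finset ι) → Prop :=
  Relation.ReflTransGen IsElementaryCollapse

/-- `IsFaceCollapsible F`: the family of faces `F` is **collapsible**, `F ↘ {v}`: it collapses
simplicially to (the complex consisting of) a single vertex.  Equivalently: all faces but one
vertex can be ordered into pairs `(σᵢ ⊂ τᵢ)`, `dim τᵢ = dim σᵢ + 1`, with `σᵢ` a free face of `τᵢ`
in what remains after removing the pairs `j < i`.  Whitehead (1939), §3; Rourke–Sanderson (1972),
Ch. 3. [cite: Whitehead1939, §3] -/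
def IsFaceCollapsible (F : Set (Finset ι)) : Prop :=
  ∃ v : ι, FaceCollapses F {({v} : Finset ι)}

namespace IsFreeFace

variable {F : Set (Finset ι)} {σ τ ρ : Finset ι}

/-- The free face belongs to the family. [folklore] -/
theorem fst_mem (h : IsFreeFace F σ τ) : σ ∈ F := h.1

/-- Its coface belongs to the family. [folklore] -/
theorem snd_mem (h : IsFreeFace F σ τ) : τ ∈ F := h.2.1

/-- A free face is a proper face of its coface. [folklore] -/
theorem ssubset (h : IsFreeFace F σ τ) : σ ⊂ τ := h.2.2.1

/-- The coface has exactly one more vertex. [folklore] -/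
theorem card_eq (h : IsFreeFace F σ τ) : τ.card = σ.card + 1 := h.2.2.2.1

/-- The coface is the unique face properly containing the free face. [folklore] -/
theorem eq_of_ssubset (h : IsFreeFace F σ τ) (hρ : ρ ∈ F) (hσρ : σ ⊂ ρ) : ρ = τ :=
  h.2.2.2.2 ρ hρ hσρ

/-- The two faces of a free pair are distinct. [folklore] -/
theorem ne (h : IsFreeFace F σ τ) : σ ≠ τ := h.ssubset.ne

/-- The coface of a free face is a facet: no face of `F` properly contains it. [folklore] -/
theorem not_ssubset (h : IsFreeFace F σ τ) (hρ : ρ ∈ F) : ¬τ ⊂ ρ := fun hτρ =>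
  hτρ.ne (h.eq_of_ssubset hρ (h.ssubset.trans hτρ)).symm

/-- Removing a free pair from a down-closed family of nonempty faces leaves a down-closed family
(the result of an elementary collapse of a simplicial complex is a subcomplex).
Rourke–Sanderson (1972), Ch. 3. [cite: RourkeSanderson1972, Ch. 3] -/
theorem isRelLowerSet_diff (h : IsFreeFace F σ τ) (hF : IsRelLowerSet F Finset.Nonempty) :
    IsRelLowerSet (F \ {σ, τ}) Finset.Nonempty := by
  intro ρ hρ
  refine ⟨(hF hρ.1).1, fun ρ' hρ'ρ hρ' => ⟨(hF hρ.1).2 hρ'ρ hρ', ?_⟩⟩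
  have hρne : ρ ≠ σ ∧ ρ ≠ τ := by
    simpa only [mem_insert_iff, mem_singleton_iff, not_or] using hρ.2
  simp only [mem_insert_iff, mem_singleton_iff, not_or]
  refine ⟨fun heq => ?_, fun heq => ?_⟩
  · -- `σ ⊆ ρ` with `ρ ≠ σ`, so `σ ⊂ ρ` and `ρ = τ`: contradiction
    have hσρ : σ ⊂ ρ :=
      Finset.ssubset_iff_subset_ne.2 ⟨heq ▸ hρ'ρ, fun h' => hρne.1 h'.symm⟩
    exact hρne.2 (h.eq_of_ssubset hρ.1 hσρ)
  · -- `τ ⊆ ρ` with `ρ ≠ τ`, so `τ ⊂ ρ`: contradicts that `τ` is a facet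
    have hτρ : τ ⊂ ρ :=
      Finset.ssubset_iff_subset_ne.2 ⟨heq ▸ hρ'ρ, fun h' => hρne.2 h'.symm⟩
    exact h.not_ssubset hρ.1 hτρ

/-- **Free faces in a complex.** In a down-closed family of nonempty faces the dimension clause
is automatic: if `σ ⊂ τ` are faces and `τ` is the only face properly containing `σ`, then
`τ.card = σ.card + 1` (any vertex `x ∈ τ ∖ σ` gives a face `σ ∪ {x} ⊆ τ` properly containing
`σ`), so `σ` is a free face of `τ`.  Rourke–Sanderson (1972), Ch. 3. [cite: RourkeSanderson1972, Ch. 3] -/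
theorem of_isRelLowerSet [DecidableEq ι] (hF : IsRelLowerSet F Finset.Nonempty) (hσ : σ ∈ F)
    (hτ : τ ∈ F) (hστ : σ ⊂ τ) (huniq : ∀ ρ ∈ F, σ ⊂ ρ → ρ = τ) : IsFreeFace F σ τ := by
  refine ⟨hσ, hτ, hστ, ?_, huniq⟩
  obtain ⟨x, hxτ, hxσ⟩ := Finset.exists_of_ssubset hστ
  have hρτ : insert x σ ⊆ τ := Finset.insert_subset hxτ hστ.1
  have hρF : insert x σ ∈ F := (hF hτ).2 hρτ (Finset.insert_nonempty x σ)
  have hσρ : σ ⊂ insert x σ := Finset.ssubset_insert hxσ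
  rw [← huniq _ hρF hσρ, Finset.card_insert_of_notMem hxσ]

end IsFreeFace

namespace FaceCollapses

variable {F G H : Set (Finset ι)}

/-- `F ↘ F`. [folklore] -/
protected theorem refl (F : Set (Finset ι)) : FaceCollapses F F := Relation.ReflTransGen.refl

/-- An elementary collapse is a collapse. [folklore] -/
theorem of_isElementaryCollapse (h : IsElementaryCollapse F G) : FaceCollapses F G :=
  Relation.ReflTransGen.single h

/-- Collapsing is transitive: `F ↘ G ↘ H` gives `F ↘ H`. [folklore] -/
protected theorem trans (h₁ : FaceCollapses F G) (h₂ : FaceCollapses G H) : FaceCollapses F H :=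
  Relation.ReflTransGen.trans h₁ h₂

/-- If `F ↘ G` then `G ⊆ F` (collapsing only removes faces). [folklore] -/
theorem subset (h : FaceCollapses F G) : G ⊆ F := by
  induction h with
  | refl => exact Subset.rfl
  | tail _ hbc ih =>
    obtain ⟨σ, τ, -, rfl⟩ := hbc
    exact Set.sdiff_subset.trans ih

/-- If `F ↘ G` and `G` is finite then `F` is finite (each step removes two faces). [folklore] -/
theorem finite (h : FaceCollapses F G) (hG : G.Finite) : F.Finite := by
  induction h with
  | refl => exact hG
  | tail _ hbc ih =>
    obtain ⟨σ, τ, -, rfl⟩ := hbc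
    exact ih ((hG.union ((finite_singleton τ).insert σ)).subset (Set.subset_sdiff_union _ _))

/-- Collapsing preserves down-closure: if `F ↘ G` and `F` is a down-closed family of nonempty
faces, so is `G`. Rourke–Sanderson (1972), Ch. 3. [cite: RourkeSanderson1972, Ch. 3] -/
theorem isRelLowerSet (h : FaceCollapses F G) (hF : IsRelLowerSet F Finset.Nonempty) :
    IsRelLowerSet G Finset.Nonempty := by
  induction h with
  | refl => exact hF
  | tail _ hbc ih =>
    obtain ⟨σ, τ, hfree, rfl⟩ := hbc
    exact hfree.isRelLowerSet_diff ih

end FaceCollapses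

/-- A single vertex is collapsible (the empty sequence of collapses). [folklore] -/
theorem isFaceCollapsible_singleton (v : ι) :
    IsFaceCollapsible ({({v} : Finset ι)} : Set (Finset ι)) :=
  ⟨v, FaceCollapses.refl _⟩

namespace IsFaceCollapsible

variable {F G : Set (Finset ι)}

/-- A collapsible family of faces is finite. [folklore] -/
theorem finite (h : IsFaceCollapsible F) : F.Finite := by
  obtain ⟨v, hv⟩ := h
  exact hv.finite (finite_singleton _)

/-- A collapsible family contains the vertex it collapses to. [folklore] -/
theorem exists_singleton_mem (h : IsFaceCollapsible F) : ∃ v : ι, ({v} : Finset ι) ∈ F := by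
  obtain ⟨v, hv⟩ := h
  exact ⟨v, hv.subset (mem_singleton _)⟩

/-- A collapsible family is nonempty. [folklore] -/
theorem nonempty (h : IsFaceCollapsible F) : F.Nonempty := by
  obtain ⟨v, hv⟩ := h.exists_singleton_mem
  exact ⟨{v}, hv⟩

/-- If `F ↘ G` and `G` is collapsible then `F` is collapsible. [folklore] -/
theorem of_faceCollapses (hFG : FaceCollapses F G) (hG : IsFaceCollapsible G) :
    IsFaceCollapsible F := by
  obtain ⟨v, hv⟩ := hG
  exact ⟨v, hFG.trans hv⟩

end IsFaceCollapsible

/-- In the closed segment `{a, b, ab}` (`a ≠ b`) the vertex `a` is a free face of the edge `ab`.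
[folklore] -/
theorem isFreeFace_segment [DecidableEq ι] {a b : ι} (hab : a ≠ b) :
    IsFreeFace ({{a}, {b}, {a, b}} : Set (Finset ι)) {a} {a, b} := by
  refine ⟨by simp, by simp, ?_, ?_, ?_⟩
  · refine Finset.ssubset_iff_subset_ne.2 ⟨by simp, fun h => hab ?_⟩
    have hb : b ∈ ({a} : Finset ι) := by rw [h]; simp
    exact (Finset.mem_singleton.1 hb).symm
  · rw [Finset.card_pair hab, Finset.card_singleton]
  · intro ρ hρ hσρ
    simp only [mem_insert_iff, mem_singleton_iff] at hρ
    rcases hρ with rfl | rfl | rfl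
    · exact (hσρ.2 hσρ.1).elim
    · have ha : a ∈ ({b} : Finset ι) := hσρ.1 (Finset.mem_singleton_self a)
      exact absurd (Finset.mem_singleton.1 ha) hab
    · rfl

/-- **The closed segment is collapsible**: `{a, b, ab} ↘ {b}` by the single elementary collapse
removing the free pair `(a ⊂ ab)`.  Rourke–Sanderson (1972), Ch. 3 (a simplex is collapsible).
[cite: RourkeSanderson1972, Ch. 3] -/
theorem isFaceCollapsible_segment [DecidableEq ι] {a b : ι} (hab : a ≠ b) :
    IsFaceCollapsible ({{a}, {b}, {a, b}} : Set (Finset ι)) := by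
  refine ⟨b, FaceCollapses.of_isElementaryCollapse ⟨{a}, {a, b}, isFreeFace_segment hab, ?_⟩⟩
  have h1 : ({b} : Finset ι) ≠ {a} := fun h => hab (Finset.singleton_injective h).symm
  have h2 : ({b} : Finset ι) ≠ {a, b} := fun h => hab <| by
    have ha : a ∈ ({b} : Finset ι) := by rw [h]; simp
    exact Finset.mem_singleton.1 ha
  ext ρ
  simp only [mem_singleton_iff, Set.mem_sdiff, mem_insert_iff, not_or]
  constructor
  · rintro rfl
    exact ⟨Or.inr (Or.inl rfl), h1, h2⟩
  · rintro ⟨h | h | h, hne1, hne2⟩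
    · exact absurd h hne1
    · exact h
    · exact absurd h hne2

end Faces

/-! ### Collapsible geometric simplicial complexes -/

section Geometric

variable {𝕜 E : Type*} [Ring 𝕜] [PartialOrder 𝕜] [AddCommGroup E] [Module 𝕜 E]

/-- `Collapses K L`, "`K ↘ L`", for geometric simplicial complexes: the faces of `K` collapse
simplicially to the faces of `L` (a finite sequence of elementary collapses, each removing a free
face together with its unique proper coface).  Whitehead (1939), §3; Rourke–Sanderson (1972),
Ch. 3. [cite: Whitehead1939, §3] -/
def Collapses (K L : Geometry.SimplicialComplex 𝕜 E) : Prop :=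
  FaceCollapses K.faces L.faces

/-- **`IsCollapsible K`**: the geometric simplicial complex `K` is **(simplicially) collapsible**,
`K ↘ pt`: its faces collapse simplicially to a single vertex — there is an ordering of all faces
but one vertex into pairs `(σᵢ ⊂ τᵢ)`, `dim τᵢ = dim σᵢ + 1`, with `σᵢ` a free face of `τᵢ` in
the subcomplex remaining after removing the pairs `j < i`.  Such a `K` is finite
(`IsCollapsible.finite`).  Whitehead (1939), §3; Rourke–Sanderson (1972), Ch. 3; Cohen,
*A course in simple-homotopy theory* (1973), §2. [cite: Whitehead1939, §3] -/
def IsCollapsible (K : Geometry.SimplicialComplex 𝕜 E) : Prop :=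
  IsFaceCollapsible K.faces

variable {K L : Geometry.SimplicialComplex 𝕜 E} {σ τ : Finset E}

/-- Unfolding: `K` is collapsible iff its faces collapse to some vertex `{v}`. [folklore] -/
theorem isCollapsible_iff :
    IsCollapsible K ↔ ∃ v : E, FaceCollapses K.faces {({v} : Finset E)} :=
  Iff.rfl

/-- **The elementary collapse of a complex.** Removing a free pair `(σ ⊂ τ)` from a geometric
simplicial complex leaves a geometric simplicial complex (down-closure is
`IsFreeFace.isRelLowerSet_diff`; affine independence and the intersection axiom are inherited).
Rourke–Sanderson (1972), Ch. 3. [cite: RourkeSanderson1972, Ch. 3] -/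
def eraseFreePair (K : Geometry.SimplicialComplex 𝕜 E) (σ τ : Finset E)
    (h : IsFreeFace K.faces σ τ) : Geometry.SimplicialComplex 𝕜 E where
  faces := K.faces \ {σ, τ}
  isRelLowerSet_faces := h.isRelLowerSet_diff K.isRelLowerSet_faces
  indep hs := K.indep hs.1
  inter_subset_convexHull hs ht := K.inter_subset_convexHull hs.1 ht.1

/-- The faces of the collapsed complex (definitional unfolding). [folklore] -/
@[simp]
theorem eraseFreePair_faces (h : IsFreeFace K.faces σ τ) :
    (eraseFreePair K σ τ h).faces = K.faces \ {σ, τ} :=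
  rfl

/-- The collapsed complex is a subcomplex. [folklore] -/
theorem eraseFreePair_le (h : IsFreeFace K.faces σ τ) : eraseFreePair K σ τ h ≤ K := by
  intro t ht
  exact ht.1

/-- `K ↘ K ∖ {σ, τ}` for a free pair. [folklore] -/
theorem collapses_eraseFreePair (h : IsFreeFace K.faces σ τ) :
    Collapses K (eraseFreePair K σ τ h) :=
  FaceCollapses.of_isElementaryCollapse ⟨σ, τ, h, rfl⟩

/-- `K ↘ K`. [folklore] -/
theorem Collapses.rfl : Collapses K K := FaceCollapses.refl _

/-- `K ↘ L ↘ L'` gives `K ↘ L'`. [folklore] -/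
theorem Collapses.trans {L' : Geometry.SimplicialComplex 𝕜 E} (h₁ : Collapses K L)
    (h₂ : Collapses L L') : Collapses K L' :=
  FaceCollapses.trans h₁ h₂

/-- If `K ↘ L` then `L` is a subcomplex of `K`. [folklore] -/
theorem Collapses.le (h : Collapses K L) : L ≤ K := FaceCollapses.subset h

/-- If `K ↘ L` and `L` is collapsible, so is `K`. [folklore] -/
theorem IsCollapsible.of_collapses (hKL : Collapses K L) (hL : IsCollapsible L) :
    IsCollapsible K :=
  IsFaceCollapsible.of_faceCollapses hKL hL

/-- A collapsible complex is finite. [folklore] -/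
theorem IsCollapsible.finite (h : IsCollapsible K) : K.faces.Finite :=
  IsFaceCollapsible.finite h

/-- A collapsible complex has a vertex (so its space is nonempty). [folklore] -/
theorem IsCollapsible.space_nonempty (h : IsCollapsible K) : K.space.Nonempty := by
  obtain ⟨v, hv⟩ := IsFaceCollapsible.exists_singleton_mem h
  exact ⟨v, K.subset_space hv (by simp)⟩

/-- The underlying space of a subcomplex is contained in that of the complex. [folklore] -/
theorem space_mono_of_le {K₀ K : Geometry.SimplicialComplex 𝕜 E} (h : K₀ ≤ K) :
    K₀.space ⊆ K.space := by
  intro x hx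
  obtain ⟨t, ht, hxt⟩ := Geometry.SimplicialComplex.mem_space_iff.1 hx
  exact Geometry.SimplicialComplex.mem_space_iff.2 ⟨t, h ht, hxt⟩

end Geometric

/-- The underlying space of a collapsible complex (in a finite-dimensional real normed space) is
compact, being a finite union of simplices
(`Literature.Analysis.Convexity.isCompact_space_of_finite`). [folklore] -/
theorem IsCollapsible.isCompact_space {W : Type*} [NormedAddCommGroup W] [NormedSpace ℝ W]
    [FiniteDimensional ℝ W] {K : Geometry.SimplicialComplex ℝ W} (h : IsCollapsible K) :
    IsCompact K.space :=
  Literature.Analysis.Convexity.isCompact_space_of_finite h.finite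

/-! ### Smoothly collapsible subsets of a smooth manifold -/

section Smooth

/-- Local notation for the model space `ℝⁿ`. -/
local notation "𝔼 " n:arg => EuclideanSpace ℝ (Fin n)
/-- Local notation for the closed unit ball `𝔻ⁿ ⊆ ℝⁿ`. -/
local notation "𝔻 " n:arg => (Metric.closedBall (0 : EuclideanSpace ℝ (Fin n)) 1)

variable (n : ℕ) {N : ℕ} {M : Type*} [TopologicalSpace M] [ChartedSpace (𝔼 n) M]

/-- `IsSmoothComplexEmbedding n K f`: the map `f : E^N → M` is a **smooth (`C^∞`) non-degenerate
embedding of the finite Euclidean simplicial complex `K`** into the charted space `M` (a smooth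
`n`-manifold in applications): `K` has finitely many faces, `f` restricts to a topological
embedding of the polyhedron `|K| = K.space`, and for every face `s` there are `g : E^N → M` and
an open `u ⊇ convexHull s` with `g` `C^∞` on `u`, `f = g` on `convexHull s`, and `mfderiv g x`
injective on the direction space `vectorSpan ℝ s` at every `x ∈ convexHull s` (`f|s` is `C^∞`
of rank `dim s`).  This is the clause of `IsSmoothTriangulation` (`SmoothTriangulation.lean`) for a
map not required to be onto `M`.  Whitehead (1940), §1; Munkres (1966), Def. 8.1 (non-degenerate `C^r`
map of a complex), Def. 8.3. [cite: Munkres1966, Def. 8.1 and Def. 8.3] -/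
def IsSmoothComplexEmbedding (K : Geometry.SimplicialComplex ℝ (𝔼 N)) (f : (𝔼 N) → M) : Prop :=
  K.faces.Finite ∧ IsEmbedding (K.space.restrict f) ∧
    ∀ s ∈ K.faces, ∃ (g : (𝔼 N) → M) (u : Set (𝔼 N)),
      IsOpen u ∧ convexHull ℝ (s : Set (𝔼 N)) ⊆ u ∧ ContMDiffOn 𝓘(ℝ, 𝔼 N) (𝓡 n) ∞ g u ∧
      (∀ y ∈ convexHull ℝ (s : Set (𝔼 N)), f y = g y) ∧
      ∀ x ∈ convexHull ℝ (s : Set (𝔼 N)),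
        InjOn (mfderiv 𝓘(ℝ, 𝔼 N) (𝓡 n) g x) (vectorSpan ℝ (s : Set (𝔼 N)) : Set (𝔼 N))

/-- **`IsSmoothlyCollapsible n s`**: the subset `s` of `M` (a charted space modelled on `ℝⁿ`) is
**smoothly collapsible**: there are a finite Euclidean simplicial complex `K`, a *collapsible*
subcomplex `K₀ ≤ K` (`IsCollapsible`) and a smooth non-degenerate embedding `f` of `K` into `M`
(`IsSmoothComplexEmbedding`) with `f(|K₀|) = s` and `f(|K|)` a neighbourhood of `s`.
That is, `s` is (the polyhedron of) a finite collapsible subcomplex of a Whitehead `C^∞`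
triangulation (Munkres 1966, Def. 8.3, Thm. 8.4) of a neighbourhood of `s` in `M`; a collapsible
subcomplex of a smooth triangulation of `M` itself qualifies
(`IsSmoothTriangulation.isSmoothlyCollapsible_image`), and `s` is compact
(`IsSmoothlyCollapsible.isCompact`).  Whitehead (1939), §3, with Whitehead (1940), §1 /
Munkres (1966), §8. [cite: Munkres1966, §8 (Def. 8.1; Def. 8.3; Thm. 8.4)] -/
def IsSmoothlyCollapsible (s : Set M) : Prop :=
  ∃ (N : ℕ) (K K₀ : Geometry.SimplicialComplex ℝ (𝔼 N)) (f : (𝔼 N) → M),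
    IsSmoothComplexEmbedding n K f ∧ K₀ ≤ K ∧ IsCollapsible K₀ ∧
    f '' K₀.space = s ∧ s ⊆ interior (f '' K.space)

variable {n}

/-- A smooth complex embedding is continuous on the polyhedron. [folklore] -/
theorem IsSmoothComplexEmbedding.continuousOn {K : Geometry.SimplicialComplex ℝ (𝔼 N)}
    {f : (𝔼 N) → M} (h : IsSmoothComplexEmbedding n K f) : ContinuousOn f K.space :=
  continuousOn_iff_continuous_restrict.2 h.2.1.continuous

/-- A smoothly collapsible subset is compact: it is the continuous image of the polyhedron of a
finite complex. [folklore] -/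
theorem IsSmoothlyCollapsible.isCompact {s : Set M} (h : IsSmoothlyCollapsible n s) :
    IsCompact s := by
  obtain ⟨N, K, K₀, f, hf, hle, hK₀, rfl, -⟩ := h
  exact hK₀.isCompact_space.image_of_continuousOn (hf.continuousOn.mono (space_mono_of_le hle))

/-- A smoothly collapsible subset is nonempty (it contains the image of a vertex). [folklore] -/
theorem IsSmoothlyCollapsible.nonempty {s : Set M} (h : IsSmoothlyCollapsible n s) :
    s.Nonempty := by
  obtain ⟨N, K, K₀, f, -, -, hK₀, rfl, -⟩ := h
  exact hK₀.space_nonempty.image f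

/-- **A collapsible subcomplex of a smooth triangulation is smoothly collapsible.**  If
`h : |K| ≃ₜ M` is a Whitehead smooth triangulation of `M` (`IsSmoothTriangulation`) and
`K₀ ≤ K` is a collapsible subcomplex, then `h(|K₀|) ⊆ M` is smoothly collapsible: take for `f`
any extension of `h` to `E^N`; its image `h(|K|) = M` is trivially a neighbourhood.
Whitehead (1940), §1; Munkres (1966), Def. 8.3. [cite: Munkres1966, Def. 8.3] -/
theorem IsSmoothTriangulation.isSmoothlyCollapsible_image
    {K K₀ : Geometry.SimplicialComplex ℝ (𝔼 N)} {h : K.space ≃ₜ M}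
    (hK : IsSmoothTriangulation n K h) (hle : K₀ ≤ K) (hK₀ : IsCollapsible K₀) :
    IsSmoothlyCollapsible n ((fun y : K.space => h y) '' (Subtype.val ⁻¹' K₀.space)) := by
  classical
  -- `M` is nonempty (it contains the image of a vertex of `K₀`), so `h` extends to `E^N`
  obtain ⟨v, hv⟩ := hK₀.space_nonempty
  let f : (𝔼 N) → M := fun x => if hx : x ∈ K.space then h ⟨x, hx⟩ else h ⟨v, space_mono_of_le hle hv⟩
  have hf : ∀ y : K.space, f y = h y := fun y => by simp [f, y.2]
  have hres : K.space.restrict f = h := funext fun y => hf y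
  refine ⟨N, K, K₀, f, ⟨hK.1, ?_, fun s hs => ?_⟩, hle, hK₀, ?_, ?_⟩
  · rw [hres]
    exact h.isEmbedding
  · obtain ⟨g, u, hu, hsu, hg, hhg, hinj⟩ := hK.2 s hs
    refine ⟨g, u, hu, hsu, hg, fun y hy => ?_, hinj⟩
    have hyK : y ∈ K.space := K.convexHull_subset_space hs hy
    rw [← hhg ⟨y, hyK⟩ hy, ← hf ⟨y, hyK⟩]
  · ext z
    constructor
    · rintro ⟨x, hx, rfl⟩
      exact ⟨⟨x, space_mono_of_le hle hx⟩, hx, (hf ⟨x, _⟩).symm⟩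
    · rintro ⟨y, hy, rfl⟩
      exact ⟨y, hy, hf y⟩
  · have hM : f '' K.space = univ := by
      refine eq_univ_of_forall fun z => ⟨(h.symm z : K.space), (h.symm z).2, ?_⟩
      rw [show ((h.symm z : K.space) : 𝔼 N) = ((h.symm z : K.space) : 𝔼 N) from rfl, hf, h.apply_symm_apply]
    rw [hM, interior_univ]
    exact subset_univ _

universe u

variable (n) in
/-- **Smooth regular neighbourhoods of collapsible complexes are balls** (named fact).  Let `M`
be a smooth `(n+1)`-manifold (Hausdorff, second countable, `C^∞`, no boundary) and `s ⊆ M` a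
smoothly collapsible subset (`IsSmoothlyCollapsible`: a collapsible finite subcomplex of a smooth
triangulation of a neighbourhood of `s`).  Then `s` has arbitrarily small neighbourhoods which
are smoothly embedded closed `(n+1)`-balls: for every open `U ⊇ s` there is a smooth embedding
`j : 𝔻ⁿ⁺¹ → M` (closed unit ball with its manifold-with-boundary structure) with `j(𝔻ⁿ⁺¹) ⊆ U`
and `s ⊆ j(open unit ball)`.
Source chain: regular neighbourhoods in a PL manifold are unique up to PL homeomorphism, a
regular neighbourhood of `Y` is one of `X` whenever `Y ↘ X`, and a PL manifold collapsing to a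
point is a PL ball, so a regular neighbourhood of a collapsible polyhedron is a PL ball
(Whitehead 1939; Rourke–Sanderson 1972, Ch. 3, Cor. 3.27; Hog-Angeloni–Metzler 1993, Ch. I §3,
(43)–(46)); for a compact subcomplex `K` of a
smooth triangulation of a smooth manifold, *smooth* regular neighbourhoods (compact
codimension-`0` smooth submanifolds-with-boundary which are regular neighbourhoods in a smooth
triangulation) exist inside any neighbourhood of `K`, are unique up to diffeomorphism, and a
smooth regular neighbourhood of `K` is one of `L` whenever `K ↘ L` (Hirsch 1962); so for
collapsible `K` they are smooth regular neighbourhoods of a vertex, i.e. smoothly embedded closed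
balls with `K` in the interior.  (In dimension `4` one may instead smooth the PL ball by
uniqueness of smoothings, Hirsch–Mazur 1974.)  Stated in dimensions `n + 1 ≥ 1`.
[cite: Hirsch1962, pp. 524–530 (existence; uniqueness; invariance under collapsing K ↘ L)]
[cite: HogAngeloniMetzler1993, Ch. I §3 (43)–(46)] -/
def exists_isSmoothEmbedding_closedBall_of_isSmoothlyCollapsible : Prop :=
  ∀ (M : Type u) [TopologicalSpace M] [T2Space M] [SecondCountableTopology M]
    [ChartedSpace (𝔼 (n + 1)) M] [IsManifold (𝓡 (n + 1)) ∞ M] (s U : Set M),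
    IsSmoothlyCollapsible (n + 1) s → IsOpen U → s ⊆ U →
    ∃ j : (𝔻 (n + 1)) → M, Manifold.IsSmoothEmbedding (𝓡∂ (n + 1)) (𝓡 (n + 1)) ∞ j ∧
      range j ⊆ U ∧ s ⊆ j '' {x | ‖(x : 𝔼 (n + 1))‖ < 1}

end Smooth

end Literature.Topology.FourManifolds

end
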